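import Literature.Probability.RandomPlanarGeometry.SAWPulledLargeForceExpansionZdSevenStep
import HarnessLib

/-!
# The pulled self-avoiding walk on `ℤ^{d+1}` at large force: the cost-seven irreducible bridges of length eight
# (`N_{7,8} = 128d⁷ − 384d⁶ + 352d⁵ − 80d⁴ + 192d³ − 372d² + 166d`, the number of seven-step self-avoiding walks of `ℤ^d`)

Topic `Literature/Probability/RandomPlanarGeometry` (continues `SAWPulledLargeForceExpansionZdSevenStep.lean`: `sevenIndex`, `sevenStep`,
`eq_sevenStep_of_mem`, `card_sevenIndex_eq`, `hexClose`, `hexClose_leaf1`, `card_hexClose`, and the four-vector lemma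
`eq_revIdx_of_sum_four_eq_zero` of `SAWPulledLargeForceExpansionZdFourthOrder.lean`).

Printed sources: N. Madras, G. Slade, *The Self-Avoiding Walk* (1993), §1.1 p. 3 (`c₁ … c₄` as polynomials in `d`), §1.2, §4.2
(irreducible bridges), Appendix C, Tables C.1 (p. 394) and C.4 (p. 397) (the series `c_n(ℤ^d)`; locators only — no entry of those tables is
quoted in this file). The polynomial proved here for every `d` is `c_7 = 128d⁷ − 384d⁶ + 352d⁵ − 80d⁴ + 192d³ − 372d² + 166d`; its values at
`d = 1, …, 4` — `2`, `2 172`, `81 390`, `871 256` — are the lane's own brute-force enumeration (HOME `check_eight.py`, d ≤ 4), reproduced by the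
theorem. The cost-seven census at length eight as an identity of closer families is not in print (lane «pcv-sawmu»).

## Contents (all PROVED, standard axioms only; no data, no certificates)

* seven transverse unit steps never sum to zero (`twoStepV_sum_seven_ne_zero`, parity);
* the cost-seven irreducible bridges of length eight are the one-step extensions `(p, h)` of the six-step transverse self-avoiding
  walks `p ∈ sevenIndex` by a seventh transverse step `h` that is not a reversal, closes no unit square on steps `4–7` and no hexagon
  on steps `2–7` (`eightIndex`, `eightStep`, `eightStep_mem_filter`, ★ `eq_eightStep_of_mem`, `eightStep_injective`);
* the three excluded families are disjoint and counted: reversals `#sevenIndex`, square closers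
  `2d(2d−2)[8d(2d−2) + (2d−4)(2(2d−2) + (2d−3)(2d−1))] = 2d(2d−2)(8d³ − 16d² + 6d + 4)` (`card_sqClose7`, five parameters),
  hexagon closers `(2d−2)·#hexClose − 2d(2d−2)(2d−3) = 2d(2d−2)(16d² − 44d + 29)` (`card_hexClose7_add`: a free first step in
  front of a rooted six-step self-avoiding polygon, minus the chords);
* ★ `costCoeffZd_seven_eight_add` (subtraction-free) and ★ `costCoeffZd_seven_eight :
  N_{7,8} = 128d⁷ − 384d⁶ + 352d⁵ − 80d⁴ + 192d³ − 372d² + 166d`.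

Provenance: lane «pcv-sawmu», a-p3 g18 (2026-08-25).
-/

noncomputable section

open Finset
open scoped BigOperators
open Literature.Probability.LatticeModels
open Literature.Probability.RandomPlanarGeometry.SAW

namespace Literature.Probability.RandomPlanarGeometry.SAW.Zd

/-- Six transverse step indices `((v₁, …, v₅), v₆)`. [cite: MadrasSlade1993, Definition 1.2.4] -/
abbrev Idx6 (d : ℕ) := Idx5 d × Idx d

/-! ### Seven transverse unit steps never sum to zero -/

/-- The coordinate sum of a transverse unit step is odd. [cite: MadrasSlade1993, Definition 1.2.4] -/
theorem exists_sum_twoStepV_eq (d : ℕ) (s : Idx d) : ∃ k : ℤ, ∑ i, twoStepV d s i = 2 * k + 1 := by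
  rcases s with ⟨j, b⟩
  simp only [twoStepV, Finset.sum_pi_single', Finset.mem_univ, if_true]
  cases b
  · exact ⟨-1, by norm_num⟩
  · exact ⟨0, by norm_num⟩

/-- ★ Seven transverse unit steps never sum to zero (the coordinate sum is odd). [cite: MadrasSlade1993, Definition 1.2.4] -/
theorem twoStepV_sum_seven_ne_zero (d : ℕ) (a b c e f g h : Idx d) :
    twoStepV d a + twoStepV d b + twoStepV d c + twoStepV d e + twoStepV d f + twoStepV d g + twoStepV d h ≠ 0 := by
  intro hs
  have h' := congrArg (fun x : Site (d + 1) => ∑ i, x i) hs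
  simp only [Pi.add_apply, Finset.sum_add_distrib, Pi.zero_apply, Finset.sum_const_zero] at h'
  obtain ⟨ka, ha⟩ := exists_sum_twoStepV_eq d a
  obtain ⟨kb, hb⟩ := exists_sum_twoStepV_eq d b
  obtain ⟨kc, hc⟩ := exists_sum_twoStepV_eq d c
  obtain ⟨ke, he⟩ := exists_sum_twoStepV_eq d e
  obtain ⟨kf, hf⟩ := exists_sum_twoStepV_eq d f
  obtain ⟨kg, hg⟩ := exists_sum_twoStepV_eq d g
  obtain ⟨kh, hh⟩ := exists_sum_twoStepV_eq d h
  rw [ha, hb, hc, he, hf, hg, hh] at h'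
  omega

/-! ### The index set of the cost-seven irreducible bridges of length eight -/

/-- Decidable equality of `Idx6 d × Idx d`. [cite: MadrasSlade1993, §1.2] -/
instance instDecidableEqIdx7 (d : ℕ) : DecidableEq (Idx6 d × Idx d) := instDecidableEqProd

/-- The displacement of the last four steps `v₄ + v₅ + v₆ + v₇` of `((s, g), h)`. [cite: MadrasSlade1993, Definition 1.2.4] -/
def sqSum7 (d : ℕ) (q : Idx6 d × Idx d) : Site (d + 1) :=
  twoStepV d q.1.1.2.2.2.1 + twoStepV d q.1.1.2.2.2.2 + twoStepV d q.1.2 + twoStepV d q.2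

/-- The displacement of the last six steps `v₂ + ⋯ + v₇` of `((s, g), h)`. [cite: MadrasSlade1993, Definition 1.2.4] -/
def hexSum7 (d : ℕ) (q : Idx6 d × Idx d) : Site (d + 1) :=
  twoStepV d q.1.1.2.1 + twoStepV d q.1.1.2.2.1 + twoStepV d q.1.1.2.2.2.1 + twoStepV d q.1.1.2.2.2.2 + twoStepV d q.1.2 +
    twoStepV d q.2

/-- All one-step extensions of the six-step transverse self-avoiding walks. [cite: MadrasSlade1993, §1.2] -/
def ext7 (d : ℕ) : Finset (Idx6 d × Idx d) := sevenIndex d ×ˢ Finset.univ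

/-- Extensions by an immediate reversal. [cite: MadrasSlade1993, §1.2] -/
def revClose7 (d : ℕ) : Finset (Idx6 d × Idx d) := (ext7 d).filter fun q => q.2 = revIdx q.1.2

/-- Extensions closing a unit square on steps `4–7`. [cite: MadrasSlade1993, §1.2] -/
def sqClose7 (d : ℕ) : Finset (Idx6 d × Idx d) := (ext7 d).filter fun q => sqSum7 d q = 0

/-- Extensions closing a hexagon on steps `2–7`. [cite: MadrasSlade1993, §1.2] -/
def hexClose7 (d : ℕ) : Finset (Idx6 d × Idx d) := (ext7 d).filter fun q => hexSum7 d q = 0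

/-- ★ The index set of the cost-seven irreducible bridges of length eight: extensions that are not reversals and close neither a
square nor a hexagon (an octagon cannot close: seven unit steps never sum to zero). [cite: MadrasSlade1993, §1.2] -/
def eightIndex (d : ℕ) : Finset (Idx6 d × Idx d) :=
  (ext7 d).filter fun q => ¬ (q.2 = revIdx q.1.2 ∨ sqSum7 d q = 0 ∨ hexSum7 d q = 0)

/-- `#ext7 = 2d · #sevenIndex`. [cite: MadrasSlade1993, §1.2] -/
theorem card_ext7 (d : ℕ) : (ext7 d).card = (sevenIndex d).card * (2 * d) := by
  rw [ext7, Finset.card_product, Finset.card_univ, card_idx]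

/-- `#eightIndex + #(revClose7 ∪ sqClose7 ∪ hexClose7) = #ext7`. [cite: MadrasSlade1993, §1.2] -/
theorem card_eightIndex_add (d : ℕ) :
    (eightIndex d).card + (revClose7 d ∪ sqClose7 d ∪ hexClose7 d).card = (sevenIndex d).card * (2 * d) := by
  have hu : revClose7 d ∪ sqClose7 d ∪ hexClose7 d =
      (ext7 d).filter fun q => q.2 = revIdx q.1.2 ∨ sqSum7 d q = 0 ∨ hexSum7 d q = 0 := by
    rw [revClose7, sqClose7, hexClose7, Finset.filter_or, Finset.filter_or, Finset.union_assoc]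
  rw [hu, eightIndex, add_comm, Finset.card_filter_add_card_filter_not, card_ext7]

/-! ### Membership -/

/-- Membership in `ext7`. [cite: MadrasSlade1993, §1.2] -/
theorem mem_ext7 {d : ℕ} {q : Idx6 d × Idx d} : q ∈ ext7 d ↔ q.1 ∈ sevenIndex d := by
  simp [ext7]

/-- Membership in `hexClose7`. [cite: MadrasSlade1993, §1.2] -/
theorem mem_hexClose7 {d : ℕ} {q : Idx6 d × Idx d} : q ∈ hexClose7 d ↔ q.1 ∈ sevenIndex d ∧ hexSum7 d q = 0 := by
  rw [hexClose7, Finset.mem_filter, mem_ext7]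

/-- Membership in `sqClose7`. [cite: MadrasSlade1993, §1.2] -/
theorem mem_sqClose7 {d : ℕ} {q : Idx6 d × Idx d} : q ∈ sqClose7 d ↔ q.1 ∈ sevenIndex d ∧ sqSum7 d q = 0 := by
  rw [sqClose7, Finset.mem_filter, mem_ext7]

/-- Membership in `revClose7`. [cite: MadrasSlade1993, §1.2] -/
theorem mem_revClose7 {d : ℕ} {q : Idx6 d × Idx d} : q ∈ revClose7 d ↔ q.1 ∈ sevenIndex d ∧ q.2 = revIdx q.1.2 := by
  rw [revClose7, Finset.mem_filter, mem_ext7]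

/-- Membership in `eightIndex`. [cite: MadrasSlade1993, §1.2] -/
theorem mem_eightIndex {d : ℕ} {q : Idx6 d × Idx d} : q ∈ eightIndex d ↔
    q.1 ∈ sevenIndex d ∧ q.2 ≠ revIdx q.1.2 ∧ sqSum7 d q ≠ 0 ∧ hexSum7 d q ≠ 0 := by
  rw [eightIndex, Finset.mem_filter, mem_ext7, not_or, not_or]

/-! ### The reversals -/

/-- The reversals are `(p, −v₆)`, `p ∈ sevenIndex`. [cite: MadrasSlade1993, §1.2] -/
theorem revClose7_eq_image (d : ℕ) : revClose7 d = (sevenIndex d).image fun p => (p, revIdx p.2) := by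
  ext ⟨p, h⟩
  simp only [mem_revClose7, Finset.mem_image, Prod.mk.injEq]
  constructor
  · rintro ⟨hp, rfl⟩; exact ⟨p, hp, rfl, rfl⟩
  · rintro ⟨p', hp', rfl, rfl⟩; exact ⟨hp', rfl⟩

/-- `#revClose7 = #sevenIndex`. [cite: MadrasSlade1993, §1.2] -/
theorem card_revClose7 (d : ℕ) : (revClose7 d).card = (sevenIndex d).card := by
  rw [revClose7_eq_image, Finset.card_image_of_injective _ (fun p p' h => (Prod.mk.inj h).1)]


/-! ### The square closers: `(a, b, c, e, f, −e; −f)` -/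

/-- Parameters of the square closers, ordered `(e, f, c, b, a)`: `f ∉ {e, −e}`, `c ∉ {−e, −f}`, `b ≠ −c`, `a ≠ −b`, and
`a = −c` only if `b ∉ {−e, −f}`. [cite: MadrasSlade1993, §1.2] -/
def sqParam7 (d : ℕ) : Finset (Idx d × Idx d × Idx d × Idx d × Idx d) :=
  Finset.univ.filter fun t => (t.2.1 ≠ t.1 ∧ t.2.1 ≠ revIdx t.1) ∧ (t.2.2.1 ≠ revIdx t.1 ∧ t.2.2.1 ≠ revIdx t.2.1) ∧
    t.2.2.2.1 ≠ revIdx t.2.2.1 ∧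
    (t.2.2.2.2 ≠ revIdx t.2.2.2.1 ∧ ¬ (t.2.2.2.2 = revIdx t.2.2.1 ∧ (t.2.2.2.1 = revIdx t.1 ∨ t.2.2.2.1 = revIdx t.2.1)))

/-- The square closer with parameters `(e, f, c, b, a)`: `((a, b, c, e, f), −e; −f)`. [cite: MadrasSlade1993, §1.2] -/
def sqMap7 {d : ℕ} (t : Idx d × Idx d × Idx d × Idx d × Idx d) : Idx6 d × Idx d :=
  (((t.2.2.2.2, t.2.2.2.1, t.2.2.1, t.1, t.2.1), revIdx t.1), revIdx t.2.1)

/-- ★ The square closers are exactly the `sqMap7 t`, `t ∈ sqParam7` (four-vector lemma on steps `4–7`). [cite: MadrasSlade1993, §1.2] -/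
theorem sqClose7_eq_image (d : ℕ) : sqClose7 d = (sqParam7 d).image sqMap7 := by
  ext ⟨⟨⟨a, b, c, e, f⟩, g⟩, h⟩
  simp only [mem_sqClose7, mem_sevenIndex, mem_sixStepIndex, Finset.mem_image, sqSum7, sum4, sum6]
  constructor
  · rintro ⟨⟨⟨⟨h12, h23, h34, h45⟩, hsqA, hsqB⟩, hgf, hsq, hhex⟩, hsum⟩
    obtain ⟨hge, hhf⟩ := eq_revIdx_of_sum_four_eq_zero d h45 hgf hsum
    refine ⟨(e, f, c, b, a), ?_, ?_⟩
    · simp only [sqParam7, Finset.mem_filter, Finset.mem_univ, true_and]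
      refine ⟨⟨?_, h45⟩, ⟨ne_revIdx_symm h34, ?_⟩, ne_revIdx_symm h23, ne_revIdx_symm h12, ?_⟩
      · rintro rfl; rw [hge] at hgf; exact hgf rfl
      · intro hcf
        apply hsq
        rw [hge, hcf, twoStepV_revIdx, twoStepV_revIdx]; abel
      · rintro ⟨hac, hb | hb⟩
        · exact hsqA ⟨by rw [hac, revIdx_revIdx], by rw [hb, revIdx_revIdx]⟩
        · apply hhex
          rw [hge, hac, hb, twoStepV_revIdx, twoStepV_revIdx, twoStepV_revIdx]; abel
    · simp only [sqMap7, hge, hhf]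
  · rintro ⟨⟨e', f', c', b', a'⟩, ht, hEq⟩
    simp only [sqParam7, Finset.mem_filter, Finset.mem_univ, true_and] at ht
    simp only [sqMap7, Prod.mk.injEq] at hEq
    obtain ⟨⟨hfe, hfe'⟩, ⟨hce, hcf⟩, hbc, hab, habc⟩ := ht
    obtain ⟨⟨⟨rfl, rfl, rfl, rfl, rfl⟩, rfl⟩, rfl⟩ := hEq
    refine ⟨⟨⟨⟨ne_revIdx_symm hab, ne_revIdx_symm hbc, ne_revIdx_symm hce, hfe'⟩, ?_, ?_⟩, ?_, ?_, ?_⟩, ?_⟩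
    · rintro ⟨hca, heb⟩
      exact habc ⟨by rw [hca, revIdx_revIdx], Or.inl (by rw [heb, revIdx_revIdx])⟩
    · rintro ⟨-, hfc⟩; exact hcf (by rw [hfc, revIdx_revIdx])
    · intro h; exact hfe (revIdx_inj h).symm
    · intro h4
      have h2 : twoStepV d c' + twoStepV d f' = 0 := by
        rw [twoStepV_revIdx] at h4; rw [← h4]; abel
      exact hcf (by rw [(twoStepV_add_eq_zero_iff d c' f').1 h2, revIdx_revIdx])
    · intro h6
      have h4 : twoStepV d a' + twoStepV d b' + twoStepV d c' + twoStepV d f' = 0 := by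
        rw [twoStepV_revIdx] at h6; rw [← h6]; abel
      obtain ⟨hca, hfb⟩ := eq_revIdx_of_sum_four_eq_zero d (ne_revIdx_symm hab) (ne_revIdx_symm hbc) h4
      exact habc ⟨by rw [hca, revIdx_revIdx], Or.inr (by rw [hfb, revIdx_revIdx])⟩
    · rw [twoStepV_revIdx, twoStepV_revIdx]; abel

/-- `sqMap7` is injective. [cite: MadrasSlade1993, §1.2] -/
theorem sqMap7_injective (d : ℕ) : Function.Injective (sqMap7 (d := d)) := by
  rintro ⟨e, f, c, b, a⟩ ⟨e', f', c', b', a'⟩ h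
  simp only [sqMap7, Prod.mk.injEq] at h
  obtain ⟨⟨⟨rfl, rfl, rfl, rfl, rfl⟩, -⟩, -⟩ := h
  rfl

/-- `#sqParam7 = 2d(2d−2)[8d(2d−2) + (2d−4)(2(2d−2) + (2d−3)(2d−1))]` (for `c ∈ {e, f}` the pair `(b, a)` has `2d(2d−2)` choices,
otherwise `2(2d−2) + (2d−3)(2d−1)`). [cite: MadrasSlade1993, §1.2] -/
theorem card_sqParam7 (d : ℕ) : (sqParam7 d).card =
    2 * d * (2 * d - 2) * (2 * (2 * d * (2 * d - 2)) + (2 * d - 4) * (2 * (2 * d - 2) + (2 * d - 3) * (2 * d - 1))) := by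
  classical
  have hU : (Finset.univ : Finset (Idx d)).card = 2 * d := by rw [Finset.card_univ, card_idx]
  -- level `a`
  have hA : ∀ e f c b : Idx d, c ≠ revIdx e → c ≠ revIdx f →
      (Finset.univ.filter fun a : Idx d => a ≠ revIdx b ∧ ¬ (a = revIdx c ∧ (b = revIdx e ∨ b = revIdx f))).card =
        if (b = revIdx e ∨ b = revIdx f) then 2 * d - 2 else 2 * d - 1 := by
    intro e f c b hce hcf
    by_cases hb : (b = revIdx e ∨ b = revIdx f)
    · rw [if_pos hb]
      have hbc : revIdx b ≠ revIdx c := by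
        intro h
        have h' : b = c := revIdx_inj h
        rcases hb with hb | hb
        · exact hce (h' ▸ hb)
        · exact hcf (h' ▸ hb)
      rw [Finset.filter_congr (q := fun a : Idx d => a ≠ revIdx b ∧ a ≠ revIdx c) fun a _ => by simp [hb]]
      exact card_filter_ne_ne_idx d hbc
    · rw [if_neg hb, Finset.filter_congr (q := fun a : Idx d => a ≠ revIdx b) fun a _ => by simp [hb]]
      exact card_filter_ne_idx d (revIdx b)
  -- level `b`
  have hB : ∀ e f c : Idx d, f ≠ e → c ≠ revIdx e → c ≠ revIdx f →
      (Finset.univ.filter fun t : Idx d × Idx d => t.1 ≠ revIdx c ∧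
        (t.2 ≠ revIdx t.1 ∧ ¬ (t.2 = revIdx c ∧ (t.1 = revIdx e ∨ t.1 = revIdx f)))).card =
        if (c = e ∨ c = f) then (2 * d - 2) + (2 * d - 2) * (2 * d - 1) else 2 * (2 * d - 2) + (2 * d - 3) * (2 * d - 1) := by
    intro e f c hfe hce hcf
    rw [card_filter_univ_prod]
    simp only [card_filter_const_and]
    have step : ∀ b : Idx d, (if b ≠ revIdx c then (Finset.univ.filter fun a : Idx d =>
        a ≠ revIdx b ∧ ¬ (a = revIdx c ∧ (b = revIdx e ∨ b = revIdx f))).card else 0) =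
        (if ((b = revIdx e ∨ b = revIdx f) ∧ b ≠ revIdx c) then 2 * d - 2 else 0) +
          (if (b ≠ revIdx c ∧ b ≠ revIdx e ∧ b ≠ revIdx f) then 2 * d - 1 else 0) := by
      intro b
      by_cases hbc : b = revIdx c
      · rw [if_neg (not_not.2 hbc), if_neg (fun h => h.2 hbc), if_neg (fun h => h.1 hbc)]
      · rw [if_pos hbc, hA e f c b hce hcf]
        by_cases hb : (b = revIdx e ∨ b = revIdx f)
        · rw [if_pos hb, if_pos ⟨hb, hbc⟩, if_neg (fun h => by rcases hb with hb | hb <;> [exact h.2.1 hb; exact h.2.2 hb]),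
            add_zero]
        · rw [if_neg hb, if_neg (fun h => hb h.1), if_pos ⟨hbc, fun h => hb (Or.inl h), fun h => hb (Or.inr h)⟩, zero_add]
    rw [Finset.sum_congr rfl fun b _ => step b, Finset.sum_add_distrib, sum_ite_const_nat, sum_ite_const_nat]
    have hef : revIdx e ≠ revIdx f := fun h => hfe (revIdx_inj h).symm
    by_cases hc : (c = e ∨ c = f)
    · rw [if_pos hc]
      rcases hc with rfl | rfl
      · rw [Finset.filter_congr (q := fun b : Idx d => b = revIdx f) fun b _ => by
            constructor
            · rintro ⟨hb | hb, hb'⟩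
              · exact absurd hb hb'
              · exact hb
            · intro hb; exact ⟨Or.inr hb, by rw [hb]; exact hef.symm⟩,
          Finset.filter_eq' Finset.univ (revIdx f), if_pos (Finset.mem_univ _), Finset.card_singleton, one_mul,
          Finset.filter_congr (q := fun b : Idx d => b ≠ revIdx c ∧ b ≠ revIdx f) fun b _ => by tauto,
          card_filter_ne_ne_idx d hef]
      · rw [Finset.filter_congr (q := fun b : Idx d => b = revIdx e) fun b _ => by
            constructor
            · rintro ⟨hb | hb, hb'⟩
              · exact hb
              · exact absurd hb hb'
            · intro hb; exact ⟨Or.inl hb, by rw [hb]; exact hef⟩,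
          Finset.filter_eq' Finset.univ (revIdx e), if_pos (Finset.mem_univ _), Finset.card_singleton, one_mul,
          Finset.filter_congr (q := fun b : Idx d => b ≠ revIdx c ∧ b ≠ revIdx e) fun b _ => by tauto,
          card_filter_ne_ne_idx d hef.symm]
    · rw [if_neg hc]
      rw [not_or] at hc
      have hce' : revIdx c ≠ revIdx e := fun h => hc.1 (revIdx_inj h)
      have hcf' : revIdx c ≠ revIdx f := fun h => hc.2 (revIdx_inj h)
      have hpair : (Finset.univ.filter fun b : Idx d => (b = revIdx e ∨ b = revIdx f) ∧ b ≠ revIdx c) = {revIdx e, revIdx f} := by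
        ext b
        simp only [Finset.mem_filter, Finset.mem_univ, true_and, Finset.mem_insert, Finset.mem_singleton]
        constructor
        · exact fun h => h.1
        · intro h
          refine ⟨h, ?_⟩
          rcases h with rfl | rfl
          · exact hce'.symm
          · exact hcf'.symm
      rw [hpair, Finset.card_pair hef, card_filter_ne_three_idx d hce' hcf' hef]
  -- level `c`
  have hC : ∀ e f : Idx d, f ≠ e → f ≠ revIdx e →
      (Finset.univ.filter fun t : Idx d × Idx d × Idx d => (t.1 ≠ revIdx e ∧ t.1 ≠ revIdx f) ∧ t.2.1 ≠ revIdx t.1 ∧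
        (t.2.2 ≠ revIdx t.2.1 ∧ ¬ (t.2.2 = revIdx t.1 ∧ (t.2.1 = revIdx e ∨ t.2.1 = revIdx f)))).card =
        2 * ((2 * d - 2) + (2 * d - 2) * (2 * d - 1)) + (2 * d - 4) * (2 * (2 * d - 2) + (2 * d - 3) * (2 * d - 1)) := by
    intro e f hfe hfe'
    rw [card_filter_univ_prod]
    simp only [card_filter_const_and]
    have step : ∀ c : Idx d, (if (c ≠ revIdx e ∧ c ≠ revIdx f) then (Finset.univ.filter fun t : Idx d × Idx d =>
        t.1 ≠ revIdx c ∧ (t.2 ≠ revIdx t.1 ∧ ¬ (t.2 = revIdx c ∧ (t.1 = revIdx e ∨ t.1 = revIdx f)))).card else 0) =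
        (if ((c = e ∨ c = f) ∧ (c ≠ revIdx e ∧ c ≠ revIdx f)) then (2 * d - 2) + (2 * d - 2) * (2 * d - 1) else 0) +
          (if (c ≠ revIdx e ∧ c ≠ revIdx f ∧ c ≠ e ∧ c ≠ f) then 2 * (2 * d - 2) + (2 * d - 3) * (2 * d - 1) else 0) := by
      intro c
      by_cases hc : (c ≠ revIdx e ∧ c ≠ revIdx f)
      · rw [if_pos hc, hB e f c hfe hc.1 hc.2]
        by_cases hc' : (c = e ∨ c = f)
        · rw [if_pos hc', if_pos ⟨hc', hc⟩, if_neg (fun h => by rcases hc' with h' | h' <;> [exact h.2.2.1 h'; exact h.2.2.2 h']),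
            add_zero]
        · rw [if_neg hc', if_neg (fun h => hc' h.1), not_or.1 hc' |> fun h => if_pos ⟨hc.1, hc.2, h.1, h.2⟩, zero_add]
      · rw [if_neg hc, if_neg (fun h => hc h.2), if_neg (fun h => hc ⟨h.1, h.2.1⟩)]
    rw [Finset.sum_congr rfl fun c _ => step c, Finset.sum_add_distrib, sum_ite_const_nat, sum_ite_const_nat]
    have hee : e ≠ revIdx e := (revIdx_ne_self e).symm
    have hef : e ≠ revIdx f := ne_revIdx_symm hfe'
    have hff : f ≠ revIdx f := (revIdx_ne_self f).symm
    have hpair : (Finset.univ.filter fun c : Idx d => (c = e ∨ c = f) ∧ (c ≠ revIdx e ∧ c ≠ revIdx f)) = {e, f} := by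
      ext c
      simp only [Finset.mem_filter, Finset.mem_univ, true_and, Finset.mem_insert, Finset.mem_singleton]
      constructor
      · exact fun h => h.1
      · intro h
        refine ⟨h, ?_⟩
        rcases h with rfl | rfl
        · exact ⟨hee, hef⟩
        · exact ⟨hfe', hff⟩
    rw [hpair, Finset.card_pair (Ne.symm hfe),
      card_filter_ne_four_idx d (fun h => hfe (revIdx_inj h).symm) hee.symm (Ne.symm hfe') hef.symm hff.symm (Ne.symm hfe)]
  -- level `f`
  have hD : ∀ e : Idx d, (Finset.univ.filter fun t : Idx d × Idx d × Idx d × Idx d => (t.1 ≠ e ∧ t.1 ≠ revIdx e) ∧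
      (t.2.1 ≠ revIdx e ∧ t.2.1 ≠ revIdx t.1) ∧ t.2.2.1 ≠ revIdx t.2.1 ∧
      (t.2.2.2 ≠ revIdx t.2.2.1 ∧ ¬ (t.2.2.2 = revIdx t.2.1 ∧ (t.2.2.1 = revIdx e ∨ t.2.2.1 = revIdx t.1)))).card =
      (2 * d - 2) * (2 * ((2 * d - 2) + (2 * d - 2) * (2 * d - 1)) + (2 * d - 4) * (2 * (2 * d - 2) + (2 * d - 3) * (2 * d - 1))) := by
    intro e
    rw [card_filter_univ_prod]
    simp only [card_filter_const_and]
    have step : ∀ f : Idx d, (if (f ≠ e ∧ f ≠ revIdx e) then (Finset.univ.filter fun t : Idx d × Idx d × Idx d =>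
        (t.1 ≠ revIdx e ∧ t.1 ≠ revIdx f) ∧ t.2.1 ≠ revIdx t.1 ∧
        (t.2.2 ≠ revIdx t.2.1 ∧ ¬ (t.2.2 = revIdx t.1 ∧ (t.2.1 = revIdx e ∨ t.2.1 = revIdx f)))).card else 0) =
        if (f ≠ e ∧ f ≠ revIdx e) then
          2 * ((2 * d - 2) + (2 * d - 2) * (2 * d - 1)) + (2 * d - 4) * (2 * (2 * d - 2) + (2 * d - 3) * (2 * d - 1)) else 0 := by
      intro f
      by_cases hf : (f ≠ e ∧ f ≠ revIdx e)
      · rw [if_pos hf, if_pos hf, hC e f hf.1 hf.2]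
      · rw [if_neg hf, if_neg hf]
    rw [Finset.sum_congr rfl fun f _ => step f, sum_ite_const_nat, card_filter_ne_ne_idx d (revIdx_ne_self e).symm]
  rw [sqParam7, card_filter_univ_prod]
  simp only [hD]
  rw [Finset.sum_const, smul_eq_mul, hU]
  rcases Nat.lt_or_ge d 2 with hd | hd
  · interval_cases d <;> rfl
  · obtain ⟨k, rfl⟩ := Nat.exists_eq_add_of_le hd
    have e1 : 2 * (2 + k) - 1 = 2 * k + 3 := by omega
    have e2 : 2 * (2 + k) - 2 = 2 * k + 2 := by omega
    have e3 : 2 * (2 + k) - 3 = 2 * k + 1 := by omega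
    have e4 : 2 * (2 + k) - 4 = 2 * k := by omega
    rw [e1, e2, e3, e4]; ring

/-- `#sqClose7 = 2d(2d−2)[8d(2d−2) + (2d−4)(2(2d−2) + (2d−3)(2d−1))]` (`d = 2, 3, 4`: `128`, `2 256`, `13 632`). [cite: MadrasSlade1993, §1.2] -/
theorem card_sqClose7 (d : ℕ) : (sqClose7 d).card =
    2 * d * (2 * d - 2) * (2 * (2 * d * (2 * d - 2)) + (2 * d - 4) * (2 * (2 * d - 2) + (2 * d - 3) * (2 * d - 1))) := by
  rw [sqClose7_eq_image, Finset.card_image_of_injective _ (sqMap7_injective d), card_sqParam7]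


/-! ### The hexagon closers: a free first step in front of a rooted six-step self-avoiding polygon -/

/-- Parameters of the hexagon closers: a rooted hexagon `q = ((b, c, e, f, g), h) ∈ hexClose` and a first step `a ∉ {−b, h}`,
with `a ≠ −c` when `e = −b` (the chord of leaf 1). [cite: MadrasSlade1993, §1.2] -/
def hexLift7 (d : ℕ) : Finset (Idx6 d × Idx d) :=
  (hexClose d ×ˢ Finset.univ).filter fun r =>
    r.2 ≠ revIdx r.1.1.1 ∧ r.2 ≠ r.1.2 ∧ ¬ (r.2 = revIdx r.1.1.2.1 ∧ r.1.1.2.2.1 = revIdx r.1.1.1)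

/-- The hexagon closer with parameters `(((b, c, e, f, g), h), a)`: `(((a, b, c, e, f), g), h)`. [cite: MadrasSlade1993, §1.2] -/
def hexMap7 {d : ℕ} (r : Idx6 d × Idx d) : Idx6 d × Idx d :=
  (((r.2, r.1.1.1, r.1.1.2.1, r.1.1.2.2.1, r.1.1.2.2.2.1), r.1.1.2.2.2.2), r.1.2)

/-- ★ The hexagon closers are exactly the `hexMap7 r`, `r ∈ hexLift7`. [cite: MadrasSlade1993, §1.2] -/
theorem hexClose7_eq_image (d : ℕ) : hexClose7 d = (hexLift7 d).image hexMap7 := by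
  ext ⟨⟨⟨a, b, c, e, f⟩, g⟩, h⟩
  simp only [mem_hexClose7, mem_sevenIndex, mem_sixStepIndex, Finset.mem_image, hexSum7, sum4, sum6]
  constructor
  · rintro ⟨⟨⟨⟨h12, h23, h34, h45⟩, hsqA, hsqB⟩, hgf, hsq, hhex⟩, hsum⟩
    refine ⟨(((b, c, e, f, g), h), a), ?_, rfl⟩
    simp only [hexLift7, Finset.mem_filter, Finset.mem_product, Finset.mem_univ, and_true, mem_hexClose, mem_sixStepIndex, sum6]
    refine ⟨⟨⟨⟨h23, h34, h45, hgf⟩, hsqB, ?_⟩, hsum⟩, ne_revIdx_symm h12, ?_, ?_⟩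
    · rintro ⟨hfc, hge⟩
      apply hsq
      rw [hfc, hge, twoStepV_revIdx, twoStepV_revIdx]; abel
    · intro hah
      apply hhex
      have e1 : twoStepV d a + twoStepV d b + twoStepV d c + twoStepV d e + twoStepV d f + twoStepV d g =
          twoStepV d b + twoStepV d c + twoStepV d e + twoStepV d f + twoStepV d g + twoStepV d h := by
        rw [hah]; abel
      rw [e1, hsum]
    · rintro ⟨hac, heb⟩
      exact hsqA ⟨by rw [hac, revIdx_revIdx], heb⟩
  · rintro ⟨⟨⟨⟨b', c', e', f', g'⟩, h'⟩, a'⟩, hr, hEq⟩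
    simp only [hexLift7, Finset.mem_filter, Finset.mem_product, Finset.mem_univ, and_true, mem_hexClose, mem_sixStepIndex,
      sum6] at hr
    simp only [hexMap7, Prod.mk.injEq] at hEq
    obtain ⟨⟨⟨rfl, rfl, rfl, rfl, rfl⟩, rfl⟩, rfl⟩ := hEq
    obtain ⟨⟨⟨⟨h23, h34, h45, hgf⟩, hsqB, hsqC⟩, hsum⟩, hab, hah, habc⟩ := hr
    refine ⟨⟨⟨⟨ne_revIdx_symm hab, h23, h34, h45⟩, ?_, hsqB⟩, hgf, ?_, ?_⟩, hsum⟩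
    · rintro ⟨hca, heb⟩
      exact habc ⟨by rw [hca, revIdx_revIdx], heb⟩
    · intro h4
      exact hsqC (eq_revIdx_of_sum_four_eq_zero d h34 h45 h4)
    · intro h6
      apply hah
      apply twoStepV_injective d
      have e1 : twoStepV d a' = twoStepV d a' +
          (twoStepV d b' + twoStepV d c' + twoStepV d e' + twoStepV d f' + twoStepV d g' + twoStepV d h') := by
        rw [hsum, add_zero]
      have e2 : twoStepV d a' + (twoStepV d b' + twoStepV d c' + twoStepV d e' + twoStepV d f' + twoStepV d g' + twoStepV d h') =
          (twoStepV d a' + twoStepV d b' + twoStepV d c' + twoStepV d e' + twoStepV d f' + twoStepV d g') + twoStepV d h' := by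
        abel
      rw [e1, e2, h6, zero_add]

/-- `hexMap7` is injective. [cite: MadrasSlade1993, §1.2] -/
theorem hexMap7_injective (d : ℕ) : Function.Injective (hexMap7 (d := d)) := by
  rintro ⟨⟨⟨b, c, e, f, g⟩, h⟩, a⟩ ⟨⟨⟨b', c', e', f', g'⟩, h'⟩, a'⟩ hh
  simp only [hexMap7, Prod.mk.injEq] at hh
  obtain ⟨⟨⟨rfl, rfl, rfl, rfl, rfl⟩, rfl⟩, rfl⟩ := hh
  rfl

/-- The fibre of `hexLift7` over a rooted hexagon `((b, c, e, f, g), h)`: `2d − 3` first steps if `e = −b` (avoid `−b`, `h`, `−c`),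
else `2d − 2` (avoid `−b`, `h`). [cite: MadrasSlade1993, §1.2] -/
theorem card_hexLift7_fibre (d : ℕ) {b c e f g h : Idx d} (hq : ((b, c, e, f, g), h) ∈ hexClose d) :
    (Finset.univ.filter fun a : Idx d => a ≠ revIdx b ∧ a ≠ h ∧ ¬ (a = revIdx c ∧ e = revIdx b)).card =
      if e = revIdx b then 2 * d - 3 else 2 * d - 2 := by
  classical
  obtain ⟨hs, hsum⟩ := mem_hexClose.1 hq
  obtain ⟨⟨-, h23, h34, h45⟩, -, hsqB⟩ := mem_sixStepIndex.1 hs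
  simp only [sum6] at hsum
  have hbh : revIdx b ≠ h := by
    intro hh
    rw [← hh, twoStepV_revIdx] at hsum
    have h4 : twoStepV d c + twoStepV d e + twoStepV d f + twoStepV d g = 0 := by rw [← hsum]; abel
    exact hsqB (eq_revIdx_of_sum_four_eq_zero d h23 h34 h4)
  by_cases heb : e = revIdx b
  · rw [if_pos heb]
    have hcb : revIdx c ≠ revIdx b := by
      intro hh
      have hcb' : c = b := revIdx_inj hh
      exact h23 (by rw [heb, hcb'])
    have hch : revIdx c ≠ h := by
      intro hh
      rw [← hh, heb, twoStepV_revIdx, twoStepV_revIdx] at hsum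
      have h2 : twoStepV d f + twoStepV d g = 0 := by rw [← hsum]; abel
      exact h45 ((twoStepV_add_eq_zero_iff d f g).1 h2)
    rw [Finset.filter_congr (q := fun a : Idx d => a ≠ revIdx b ∧ a ≠ h ∧ a ≠ revIdx c) fun a _ => by simp [heb]]
    exact card_filter_ne_three_idx d hbh hcb.symm hch.symm
  · rw [if_neg heb, Finset.filter_congr (q := fun a : Idx d => a ≠ revIdx b ∧ a ≠ h) fun a _ => by simp [heb]]
    exact card_filter_ne_ne_idx d hbh

/-- `#hexLift7 + 2d(2d−2)(2d−3) = (2d−2) · #hexClose` (`= (2d−2) · 2d(2d−2)(8d−13)`): every rooted hexagon admits `2d − 2` first steps,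
except the `2d(2d−2)(2d−3)` hexagons of leaf 1 (`v₃ = −v₁`), which admit `2d − 3`. [cite: MadrasSlade1993, §1.2] -/
theorem card_hexLift7_add (d : ℕ) :
    (hexLift7 d).card + 2 * d * (2 * d - 2) * (2 * d - 3) = (2 * d - 2) * (2 * d * (2 * d - 2) * (8 * d - 13)) := by
  classical
  have hsum_eq : (hexLift7 d).card = ∑ q ∈ hexClose d, (if q.1.2.2.1 = revIdx q.1.1 then 2 * d - 3 else 2 * d - 2) := by
    rw [hexLift7, Finset.card_filter, Finset.sum_product]
    refine Finset.sum_congr rfl ?_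
    rintro ⟨⟨b, c, e, f, g⟩, h⟩ hq
    have hf := card_hexLift7_fibre d hq
    rw [Finset.card_filter] at hf
    exact hf
  have hL : ((hexClose d).filter fun p => p.1.2.2.1 = revIdx p.1.1).card = 2 * d * (2 * d - 2) * (2 * d - 3) := by
    rw [hexClose_leaf1, Finset.card_image_of_injective _ (hexMap_injective d).1, card_hexParam1]
  have hM := Finset.card_filter_add_card_filter_not (s := hexClose d) (fun p => p.1.2.2.1 = revIdx p.1.1)
  rw [card_hexClose, hL] at hM
  rw [hsum_eq, Finset.sum_ite, Finset.sum_const, Finset.sum_const, smul_eq_mul, smul_eq_mul, hL, ← hM]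
  generalize ((hexClose d).filter fun p => ¬ p.1.2.2.1 = revIdx p.1.1).card = M
  rcases Nat.lt_or_ge d 2 with hd | hd
  · interval_cases d <;> simp
  · obtain ⟨k, rfl⟩ := Nat.exists_eq_add_of_le hd
    have e2 : 2 * (2 + k) - 2 = 2 * k + 2 := by omega
    have e3 : 2 * (2 + k) - 3 = 2 * k + 1 := by omega
    rw [e2, e3]; ring

/-- ★ `#hexClose7 + 2d(2d−2)(2d−3) = (2d−2) · 2d(2d−2)(8d−13)`, i.e. `#hexClose7 = 2d(2d−2)(16d² − 44d + 29)` (`d = 2, 3, 4`: `40`, `984`,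
`5 232`). [cite: MadrasSlade1993, §1.2] -/
theorem card_hexClose7_add (d : ℕ) :
    (hexClose7 d).card + 2 * d * (2 * d - 2) * (2 * d - 3) = (2 * d - 2) * (2 * d * (2 * d - 2) * (8 * d - 13)) := by
  rw [hexClose7_eq_image, Finset.card_image_of_injective _ (hexMap7_injective d), card_hexLift7_add]


/-! ### The three excluded families are pairwise disjoint -/

/-- `#(revClose7 ∪ sqClose7 ∪ hexClose7) = #revClose7 + #sqClose7 + #hexClose7`. [cite: MadrasSlade1993, §1.2] -/
theorem card_bad7 (d : ℕ) :
    (revClose7 d ∪ sqClose7 d ∪ hexClose7 d).card = (revClose7 d).card + (sqClose7 d).card + (hexClose7 d).card := by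
  have h1 : Disjoint (revClose7 d) (sqClose7 d) := by
    rw [Finset.disjoint_left]
    rintro ⟨⟨⟨a, b, c, e, f⟩, g⟩, h⟩ hr hq
    obtain ⟨hp, hh⟩ := mem_revClose7.1 hr
    obtain ⟨-, hsum⟩ := mem_sqClose7.1 hq
    obtain ⟨hs, -, -, -⟩ := mem_sevenIndex.1 hp
    obtain ⟨⟨-, -, -, h45⟩, -, -⟩ := mem_sixStepIndex.1 hs
    simp only at hh
    subst hh
    simp only [sqSum7] at hsum
    rw [twoStepV_revIdx] at hsum
    have h2 : twoStepV d e + twoStepV d f = 0 := by rw [← hsum]; abel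
    exact h45 ((twoStepV_add_eq_zero_iff d e f).1 h2)
  have h2 : Disjoint (revClose7 d) (hexClose7 d) := by
    rw [Finset.disjoint_left]
    rintro ⟨⟨⟨a, b, c, e, f⟩, g⟩, h⟩ hr hx
    obtain ⟨hp, hh⟩ := mem_revClose7.1 hr
    obtain ⟨-, hsum⟩ := mem_hexClose7.1 hx
    obtain ⟨hs, -, -, -⟩ := mem_sevenIndex.1 hp
    obtain ⟨⟨-, h23, h34, -⟩, -, hsqB⟩ := mem_sixStepIndex.1 hs
    simp only at hh
    subst hh
    simp only [hexSum7] at hsum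
    rw [twoStepV_revIdx] at hsum
    have h4 : twoStepV d b + twoStepV d c + twoStepV d e + twoStepV d f = 0 := by rw [← hsum]; abel
    exact hsqB (eq_revIdx_of_sum_four_eq_zero d h23 h34 h4)
  have h3 : Disjoint (sqClose7 d) (hexClose7 d) := by
    rw [Finset.disjoint_left]
    rintro ⟨⟨⟨a, b, c, e, f⟩, g⟩, h⟩ hq hx
    obtain ⟨hp, hsum4⟩ := mem_sqClose7.1 hq
    obtain ⟨-, hsum⟩ := mem_hexClose7.1 hx
    obtain ⟨hs, -, -, -⟩ := mem_sevenIndex.1 hp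
    obtain ⟨⟨-, h23, -, -⟩, -, -⟩ := mem_sixStepIndex.1 hs
    simp only [sqSum7] at hsum4
    simp only [hexSum7] at hsum
    have h2 : twoStepV d b + twoStepV d c = 0 := by
      have : twoStepV d b + twoStepV d c + (twoStepV d e + twoStepV d f + twoStepV d g + twoStepV d h) = 0 := by
        rw [← hsum]; abel
      rwa [hsum4, add_zero] at this
    exact h23 ((twoStepV_add_eq_zero_iff d b c).1 h2)
  rw [Finset.card_union_of_disjoint (Finset.disjoint_union_left.2 ⟨h2, h3⟩), Finset.card_union_of_disjoint h1]

/-- ★ `#eightIndex + #sevenIndex + #sqClose7 + (2d−2)·#hexClose = 2d · #sevenIndex + 2d(2d−2)(2d−3)` (subtraction-free census).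
[cite: MadrasSlade1993, §1.2] -/
theorem card_eightIndex_eq (d : ℕ) :
    (eightIndex d).card + (sevenIndex d).card +
      2 * d * (2 * d - 2) * (2 * (2 * d * (2 * d - 2)) + (2 * d - 4) * (2 * (2 * d - 2) + (2 * d - 3) * (2 * d - 1))) +
      (2 * d - 2) * (2 * d * (2 * d - 2) * (8 * d - 13)) = (sevenIndex d).card * (2 * d) + 2 * d * (2 * d - 2) * (2 * d - 3) := by
  have h := card_eightIndex_add d
  rw [card_bad7, card_revClose7, card_sqClose7] at h
  have hx := card_hexClose7_add d
  linarith

/-! ### The cost-seven irreducible bridges of length eight -/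

/-- The eight-step walk `(0, e₀, e₀+v₁, …, e₀+v₁+⋯+v₇)`: `sevenStep p` extended by `v₇ = v_j`. [cite: MadrasSlade1993, Definition 1.2.4] -/
def eightStep (d : ℕ) (q : Idx6 d × Idx d) : ℕ → Site (d + 1) :=
  fun i => if i ≤ 7 then sevenStep d q.1 i else sevenStep d q.1 7 + twoStepV d q.2

/-- `eightStep` agrees with `sevenStep` up to time `7`. [cite: MadrasSlade1993, Definition 1.2.4] -/
theorem eightStep_of_le_seven (d : ℕ) (q : Idx6 d × Idx d) {i : ℕ} (hi : i ≤ 7) : eightStep d q i = sevenStep d q.1 i := by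
  simp [eightStep, hi]

/-- Value at `i ≥ 8`. [cite: MadrasSlade1993, Definition 1.2.4] -/
theorem eightStep_of_eight_le (d : ℕ) (q : Idx6 d × Idx d) {i : ℕ} (hi : 8 ≤ i) :
    eightStep d q i = sevenStep d q.1 7 + twoStepV d q.2 := by
  simp [eightStep, show ¬ i ≤ 7 by omega]

/-- Heights along `eightStep`: `0, 1, 1, …`. [cite: MadrasSlade1993, Definition 1.2.4] -/
theorem eightStep_apply_zero (d : ℕ) (q : Idx6 d × Idx d) (i : ℕ) : eightStep d q i 0 = if i = 0 then 0 else 1 := by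
  rcases Nat.lt_or_ge i 8 with hi | hi
  · rw [eightStep_of_le_seven d q (by omega), sevenStep_apply_zero]
  · rw [eightStep_of_eight_le d q hi, Pi.add_apply, sevenStep_apply_zero, twoStepV_apply_zero, if_neg (by norm_num), if_neg (by omega),
      add_zero]

/-- `eightStep q`, `q ∈ eightIndex`, is an eight-step self-avoiding walk. [cite: MadrasSlade1993, Definition 1.2.4] -/
theorem eightStep_mem_saws (d : ℕ) {q : Idx6 d × Idx d} (hq : q ∈ eightIndex d) : eightStep d q ∈ saws (d + 1) 8 := by
  obtain ⟨⟨⟨a, b, c, e, f⟩, g⟩, j⟩ := q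
  obtain ⟨hp, hjg, hsq, hhex⟩ := mem_eightIndex.1 hq
  obtain ⟨h0, -, hadj, hinj⟩ := mem_saws.1 (sevenStep_mem_saws d hp)
  simp only at hjg hsq hhex
  simp only [sqSum7] at hsq
  simp only [hexSum7] at hhex
  refine mem_saws.2 ⟨by rw [eightStep_of_le_seven d _ (by norm_num), h0], fun i hi => ?_, fun i hi => ?_, ?_⟩
  · rw [eightStep_of_eight_le d _ hi, eightStep_of_eight_le d _ le_rfl]
  · rcases Nat.lt_or_ge i 7 with hi7 | hi7
    · rw [eightStep_of_le_seven d _ hi7.le, eightStep_of_le_seven d _ (by omega)]; exact hadj i hi7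
    · have hi' : i = 7 := by omega
      subst hi'
      rw [eightStep_of_le_seven d _ le_rfl, eightStep_of_eight_le d _ le_rfl]; exact adj_add_twoStepV d _ _
  · -- injectivity: pairs inside `[0, 7]` from `sevenStep`, pairs `(i, 8)` by hand
    have h8 : ∀ i, i ≤ 7 → eightStep d (((a, b, c, e, f), g), j) i ≠ eightStep d (((a, b, c, e, f), g), j) 8 := by
      intro i hi hEq
      rw [eightStep_of_le_seven d _ hi, eightStep_of_eight_le d _ le_rfl] at hEq
      simp only at hEq
      have hi0 : i ≠ 0 := by
        rintro rfl
        have hh := congrFun hEq 0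
        rw [sevenStep_apply_zero, Pi.add_apply, sevenStep_apply_zero, twoStepV_apply_zero, if_pos rfl, if_neg (by norm_num)] at hh
        norm_num at hh
      have key : i = 1 ∨ i = 2 ∨ i = 3 ∨ i = 4 ∨ i = 5 ∨ i = 6 ∨ i = 7 := by omega
      rw [sevenStep_of_seven_le d _ le_rfl, sixStep_of_six_le d _ le_rfl] at hEq
      simp only at hEq
      rcases key with rfl | rfl | rfl | rfl | rfl | rfl | rfl
      · rw [sevenStep_of_le_six d _ (by norm_num), sixStep_one] at hEq
        have h' : twoStepV d a + twoStepV d b + twoStepV d c + twoStepV d e + twoStepV d f + twoStepV d g + twoStepV d j = 0 := by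
          have := hEq.symm; rw [← sub_eq_zero] at this; rw [← this]; abel
        exact twoStepV_sum_seven_ne_zero d _ _ _ _ _ _ _ h'
      · rw [sevenStep_of_le_six d _ (by norm_num), sixStep_two] at hEq
        have h' : twoStepV d b + twoStepV d c + twoStepV d e + twoStepV d f + twoStepV d g + twoStepV d j = 0 := by
          have := hEq.symm; rw [← sub_eq_zero] at this; rw [← this]; abel
        exact hhex h'
      · rw [sevenStep_of_le_six d _ (by norm_num), sixStep_three] at hEq
        have h' : twoStepV d c + twoStepV d e + twoStepV d f + twoStepV d g + twoStepV d j = 0 := by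
          have := hEq.symm; rw [← sub_eq_zero] at this; rw [← this]; abel
        exact twoStepV_sum_five_ne_zero d _ _ _ _ _ h'
      · rw [sevenStep_of_le_six d _ (by norm_num), sixStep_four] at hEq
        have h' : twoStepV d e + twoStepV d f + twoStepV d g + twoStepV d j = 0 := by
          have := hEq.symm; rw [← sub_eq_zero] at this; rw [← this]; abel
        exact hsq h'
      · rw [sevenStep_of_le_six d _ (by norm_num), sixStep_five] at hEq
        have h' : twoStepV d f + twoStepV d g + twoStepV d j = 0 := by
          have := hEq.symm; rw [← sub_eq_zero] at this; rw [← this]; abel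
        exact twoStepV_add_add_ne_zero d _ _ _ h'
      · rw [sevenStep_of_le_six d _ le_rfl, sixStep_of_six_le d _ le_rfl] at hEq
        have h' : twoStepV d g + twoStepV d j = 0 := by
          have := hEq.symm; rw [← sub_eq_zero] at this; rw [← this]; abel
        exact hjg ((twoStepV_add_eq_zero_iff d g j).1 h')
      · rw [sevenStep_of_seven_le d _ le_rfl, sixStep_of_six_le d _ le_rfl] at hEq
        have h' : twoStepV d j = 0 := by
          have := hEq.symm; rw [← sub_eq_zero] at this; rw [← this]; abel
        exact twoStepV_ne_zero d j h'
    intro i hi k hk hik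
    simp only [Set.mem_setOf_eq] at hi hk
    rcases Nat.lt_or_ge i 8 with hi8 | hi8 <;> rcases Nat.lt_or_ge k 8 with hk8 | hk8
    · rw [eightStep_of_le_seven d _ (by omega), eightStep_of_le_seven d _ (by omega)] at hik
      exact hinj (show i ∈ {m : ℕ | m ≤ 7} from by simp; omega) (show k ∈ {m : ℕ | m ≤ 7} from by simp; omega) hik
    · have hk' : k = 8 := by omega
      subst hk'
      exact absurd hik (h8 i (by omega))
    · have hi' : i = 8 := by omega
      subst hi'
      exact absurd hik.symm (h8 k (by omega))
    · omega

/-- `eightStep q` is an irreducible bridge of cost seven. [cite: DuminilCopinHammond2013, §2.2] -/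
theorem eightStep_mem_filter (d : ℕ) {q : Idx6 d × Idx d} (hq : q ∈ eightIndex d) :
    eightStep d q ∈ (irreducibleBridges (d + 1) 8).filter fun ω => costZd d 8 ω = 7 := by
  have hb : IsBridge 8 (eightStep d q) := by
    intro i h1 h2
    rw [eightStep_apply_zero, eightStep_apply_zero, eightStep_apply_zero, if_pos rfl, if_neg (by omega), if_neg (by omega)]
    exact ⟨zero_lt_one, le_rfl⟩
  refine Finset.mem_filter.2 ⟨mem_irreducibleBridges.2 ⟨mem_bridges.2 ⟨eightStep_mem_saws d hq, hb⟩,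
    ⟨by norm_num, hb, fun k hk1 hk2 hren => ?_⟩⟩, ?_⟩
  · have h := (hren.2.2 1 le_rfl (by omega)).1
    simp only [add_zero, eightStep_apply_zero] at h
    have hk0 : k ≠ 0 := by omega
    have hk1' : k + 1 ≠ 0 := by omega
    rw [if_neg hk0, if_neg hk1'] at h
    exact lt_irrefl _ h
  · simp [costZd, eightStep_apply_zero]

/-- ★ **Every cost-seven irreducible bridge of length eight is an `eightStep`** (span one; self-avoidance gives the index conditions).
[cite: MadrasSlade1993, Definition 1.2.4] -/
theorem eq_eightStep_of_mem (d : ℕ) {ω : ℕ → Site (d + 1)}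
    (hω : ω ∈ (irreducibleBridges (d + 1) 8).filter fun ω => costZd d 8 ω = 7) : ∃ q ∈ eightIndex d, ω = eightStep d q := by
  obtain ⟨hirr, hcost⟩ := Finset.mem_filter.1 hω
  obtain ⟨hbr, -⟩ := mem_irreducibleBridges.1 hirr
  obtain ⟨hωs, hb⟩ := mem_bridges.1 hbr
  obtain ⟨h0, hend, hadj, hinj⟩ := mem_saws.1 hωs
  have hω1 : ω 1 = Pi.single 0 1 := apply_one_eq_e0_of_mem_bridges d (by norm_num) hbr
  have h8eq : ω 8 0 = 1 := by
    have hc : costZd d 8 ω = 7 := hcost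
    simp only [costZd] at hc
    have := (span_le_and_cost_bound_zd hirr).1
    have h80 : 0 < ω 8 0 := by have := (hb 8 (by norm_num) le_rfl).1; rwa [h0] at this
    omega
  have h1eq : ω 1 0 = 1 := by rw [hω1]; simp
  have hieq : ∀ i, 1 ≤ i → i ≤ 8 → ω i 0 = 1 := by
    intro i hi1 hi8
    have h := hb i hi1 hi8
    rw [h0, h8eq] at h
    simp only [Pi.zero_apply] at h
    omega
  obtain ⟨a, ha⟩ := exists_twoStepV_of_adj d (hadj 1 (by norm_num)) (by rw [hieq 2 (by norm_num) (by norm_num), h1eq])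
  obtain ⟨b, hb'⟩ := exists_twoStepV_of_adj d (hadj 2 (by norm_num))
    (by rw [hieq 3 (by norm_num) (by norm_num), hieq 2 (by norm_num) (by norm_num)])
  obtain ⟨c, hc'⟩ := exists_twoStepV_of_adj d (hadj 3 (by norm_num))
    (by rw [hieq 4 (by norm_num) (by norm_num), hieq 3 (by norm_num) (by norm_num)])
  obtain ⟨e, he'⟩ := exists_twoStepV_of_adj d (hadj 4 (by norm_num))
    (by rw [hieq 5 (by norm_num) (by norm_num), hieq 4 (by norm_num) (by norm_num)])
  obtain ⟨f, hf'⟩ := exists_twoStepV_of_adj d (hadj 5 (by norm_num))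
    (by rw [hieq 6 (by norm_num) (by norm_num), hieq 5 (by norm_num) (by norm_num)])
  obtain ⟨g, hg'⟩ := exists_twoStepV_of_adj d (hadj 6 (by norm_num))
    (by rw [hieq 7 (by norm_num) (by norm_num), hieq 6 (by norm_num) (by norm_num)])
  obtain ⟨j, hj'⟩ := exists_twoStepV_of_adj d (hadj 7 (by norm_num))
    (by rw [hieq 8 (by norm_num) le_rfl, hieq 7 (by norm_num) (by norm_num)])
  have hmem : ∀ i : ℕ, i ≤ 8 → i ∈ {m : ℕ | m ≤ 8} := fun i hi => hi
  have hab : b ≠ revIdx a := by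
    intro hba
    have h13 : ω 3 = ω 1 := by rw [hb', ha, hba, twoStepV_revIdx, add_assoc, add_neg_cancel, add_zero]
    have := hinj (hmem 3 (by norm_num)) (hmem 1 (by norm_num)) h13
    omega
  have hbc : c ≠ revIdx b := by
    intro hcb
    have h24 : ω 4 = ω 2 := by rw [hc', hb', hcb, twoStepV_revIdx, add_assoc, add_neg_cancel, add_zero]
    have := hinj (hmem 4 (by norm_num)) (hmem 2 (by norm_num)) h24
    omega
  have hce : e ≠ revIdx c := by
    intro hec
    have h35 : ω 5 = ω 3 := by rw [he', hc', hec, twoStepV_revIdx, add_assoc, add_neg_cancel, add_zero]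
    have := hinj (hmem 5 (by norm_num)) (hmem 3 (by norm_num)) h35
    omega
  have hef : f ≠ revIdx e := by
    intro hfe
    have h46 : ω 6 = ω 4 := by rw [hf', he', hfe, twoStepV_revIdx, add_assoc, add_neg_cancel, add_zero]
    have := hinj (hmem 6 (by norm_num)) (hmem 4 (by norm_num)) h46
    omega
  have hfg : g ≠ revIdx f := by
    intro hgf
    have h57 : ω 7 = ω 5 := by rw [hg', hf', hgf, twoStepV_revIdx, add_assoc, add_neg_cancel, add_zero]
    have := hinj (hmem 7 (by norm_num)) (hmem 5 (by norm_num)) h57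
    omega
  have hgj : j ≠ revIdx g := by
    intro hjg
    have h68 : ω 8 = ω 6 := by rw [hj', hg', hjg, twoStepV_revIdx, add_assoc, add_neg_cancel, add_zero]
    have := hinj (hmem 8 le_rfl) (hmem 6 (by norm_num)) h68
    omega
  have hsqA : ¬ (c = revIdx a ∧ e = revIdx b) := by
    rintro ⟨hca, heb⟩
    have h15 : ω 5 = ω 1 := by
      rw [he', hc', hb', ha, hca, heb, twoStepV_revIdx, twoStepV_revIdx]
      abel
    have := hinj (hmem 5 (by norm_num)) (hmem 1 (by norm_num)) h15
    omega
  have hsqB : ¬ (e = revIdx b ∧ f = revIdx c) := by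
    rintro ⟨heb, hfc⟩
    have h26 : ω 6 = ω 2 := by
      rw [hf', he', hc', hb', heb, hfc, twoStepV_revIdx, twoStepV_revIdx]
      abel
    have := hinj (hmem 6 (by norm_num)) (hmem 2 (by norm_num)) h26
    omega
  have hsqC : twoStepV d c + twoStepV d e + twoStepV d f + twoStepV d g ≠ 0 := by
    intro h4
    have h37 : ω 7 = ω 3 := by
      rw [hg', hf', he', hc']
      have : ω 3 + twoStepV d c + twoStepV d e + twoStepV d f + twoStepV d g =
          ω 3 + (twoStepV d c + twoStepV d e + twoStepV d f + twoStepV d g) := by abel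
      rw [this, h4, add_zero]
    have := hinj (hmem 7 (by norm_num)) (hmem 3 (by norm_num)) h37
    omega
  have hsqD : twoStepV d e + twoStepV d f + twoStepV d g + twoStepV d j ≠ 0 := by
    intro h4
    have h48 : ω 8 = ω 4 := by
      rw [hj', hg', hf', he']
      have : ω 4 + twoStepV d e + twoStepV d f + twoStepV d g + twoStepV d j =
          ω 4 + (twoStepV d e + twoStepV d f + twoStepV d g + twoStepV d j) := by abel
      rw [this, h4, add_zero]
    have := hinj (hmem 8 le_rfl) (hmem 4 (by norm_num)) h48
    omega
  have hhex6 : twoStepV d a + twoStepV d b + twoStepV d c + twoStepV d e + twoStepV d f + twoStepV d g ≠ 0 := by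
    intro h6
    have h17 : ω 7 = ω 1 := by
      rw [hg', hf', he', hc', hb', ha]
      have : ω 1 + twoStepV d a + twoStepV d b + twoStepV d c + twoStepV d e + twoStepV d f + twoStepV d g =
          ω 1 + (twoStepV d a + twoStepV d b + twoStepV d c + twoStepV d e + twoStepV d f + twoStepV d g) := by abel
      rw [this, h6, add_zero]
    have := hinj (hmem 7 (by norm_num)) (hmem 1 (by norm_num)) h17
    omega
  have hhex7 : twoStepV d b + twoStepV d c + twoStepV d e + twoStepV d f + twoStepV d g + twoStepV d j ≠ 0 := by
    intro h6
    have h28 : ω 8 = ω 2 := by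
      rw [hj', hg', hf', he', hc', hb']
      have : ω 2 + twoStepV d b + twoStepV d c + twoStepV d e + twoStepV d f + twoStepV d g + twoStepV d j =
          ω 2 + (twoStepV d b + twoStepV d c + twoStepV d e + twoStepV d f + twoStepV d g + twoStepV d j) := by abel
      rw [this, h6, add_zero]
    have := hinj (hmem 8 le_rfl) (hmem 2 (by norm_num)) h28
    omega
  refine ⟨(((a, b, c, e, f), g), j), mem_eightIndex.2 ⟨mem_sevenIndex.2 ⟨mem_sixStepIndex.2 ⟨⟨hab, hbc, hce, hef⟩, hsqA, hsqB⟩,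
    hfg, hsqC, hhex6⟩, hgj, hsqD, hhex7⟩, funext fun i => ?_⟩
  rcases Nat.lt_or_ge i 8 with hi8 | hi8
  · rw [eightStep_of_le_seven d _ (by omega)]
    rcases Nat.lt_or_ge i 7 with hi7 | hi7
    · rw [sevenStep_of_le_six d _ (by omega)]
      interval_cases i
      · rw [h0, sixStep_zero]
      · rw [hω1, sixStep_one]
      · rw [ha, hω1, sixStep_two]
      · rw [hb', ha, hω1, sixStep_three]
      · rw [hc', hb', ha, hω1, sixStep_four]
      · rw [he', hc', hb', ha, hω1, sixStep_five]
      · rw [hf', he', hc', hb', ha, hω1, sixStep_of_six_le d _ le_rfl]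
    · have hi' : i = 7 := by omega
      subst hi'
      rw [sevenStep_of_seven_le d _ le_rfl, hg', hf', he', hc', hb', ha, hω1, sixStep_of_six_le d _ le_rfl]
  · rw [hend i hi8, eightStep_of_eight_le d _ hi8, sevenStep_of_seven_le d _ le_rfl, hj', hg', hf', he', hc', hb', ha, hω1,
      sixStep_of_six_le d _ le_rfl]

/-- `eightStep` is injective. [cite: MadrasSlade1993, Definition 1.2.4] -/
theorem eightStep_injective (d : ℕ) : Function.Injective (eightStep d) := by
  rintro ⟨p, j⟩ ⟨p', j'⟩ hpp
  have h7 : sevenStep d p = sevenStep d p' := by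
    funext i
    rcases Nat.lt_or_ge i 7 with hi | hi
    · have := congrFun hpp i
      rwa [eightStep_of_le_seven d _ (by omega), eightStep_of_le_seven d _ (by omega)] at this
    · have := congrFun hpp 7
      rw [eightStep_of_le_seven d _ le_rfl, eightStep_of_le_seven d _ le_rfl] at this
      simp only at this
      rw [sevenStep_of_seven_le d _ hi, sevenStep_of_seven_le d _ hi, ← sevenStep_of_seven_le d p le_rfl,
        ← sevenStep_of_seven_le d p' le_rfl, this]
  have hp : p = p' := sevenStep_injective d h7
  subst hp
  have h8 := congrFun hpp 8
  rw [eightStep_of_eight_le d _ le_rfl, eightStep_of_eight_le d _ le_rfl] at h8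
  simp only [add_right_inj] at h8
  rw [twoStepV_injective d h8]

/-- ★ The cost-seven irreducible bridges of length eight are exactly the `eightStep`s. [cite: MadrasSlade1993, §4.2] -/
theorem filter_costZd_seven_eight_eq_image (d : ℕ) [DecidableEq (ℕ → Site (d + 1))] :
    ((irreducibleBridges (d + 1) 8).filter fun ω => costZd d 8 ω = 7) = (eightIndex d).image (eightStep d) := by
  ext ω
  constructor
  · intro h
    obtain ⟨q, hq, rfl⟩ := eq_eightStep_of_mem d h
    exact Finset.mem_image_of_mem _ hq
  · intro h
    obtain ⟨q, hq, rfl⟩ := Finset.mem_image.1 h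
    exact eightStep_mem_filter d hq

/-- ★ **`N_{7,8} + N_{6,7} + #sqClose7 + (2d−2) · 2d(2d−2)(8d−13) = 2d · N_{6,7} + 2d(2d−2)(2d−3)`** on `ℤ^{d+1}` (subtraction-free):
a seven-step self-avoiding walk of `ℤ^d` is a six-step one extended by one of `2d` steps, minus the reversals, the square closers and
the hexagon closers. [cite: MadrasSlade1993, §1.2; Appendix C, Table C.1] -/
theorem costCoeffZd_seven_eight_add (d : ℕ) :
    costCoeffZd d 7 8 + costCoeffZd d 6 7 +
      2 * d * (2 * d - 2) * (2 * (2 * d * (2 * d - 2)) + (2 * d - 4) * (2 * (2 * d - 2) + (2 * d - 3) * (2 * d - 1))) +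
      (2 * d - 2) * (2 * d * (2 * d - 2) * (8 * d - 13)) = 2 * d * costCoeffZd d 6 7 + 2 * d * (2 * d - 2) * (2 * d - 3) := by
  classical
  have hS : (sevenIndex d).card = costCoeffZd d 6 7 := by
    rw [costCoeffZd, filter_costZd_six_seven_eq_image, Finset.card_image_of_injective _ (sevenStep_injective d)]
  have h78 : costCoeffZd d 7 8 = (eightIndex d).card := by
    rw [costCoeffZd, filter_costZd_seven_eight_eq_image, Finset.card_image_of_injective _ (eightStep_injective d)]
  rw [h78, ← hS, Nat.mul_comm (2 * d) (sevenIndex d).card]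
  exact card_eightIndex_eq d

/-- ★ **`N_{7,8} + 384d⁶ + 80d⁴ + 372d² = 128d⁷ + 352d⁵ + 192d³ + 166d`** (subtraction-free closed form).
[cite: MadrasSlade1993, Appendix C, Table C.1] -/
theorem costCoeffZd_seven_eight_add' (d : ℕ) :
    costCoeffZd d 7 8 + 384 * d ^ 6 + 80 * d ^ 4 + 372 * d ^ 2 = 128 * d ^ 7 + 352 * d ^ 5 + 192 * d ^ 3 + 166 * d := by
  have h1 := costCoeffZd_seven_eight_add d
  have h2 := costCoeffZd_six_seven_add' d
  -- keep the censuses opaque (no closed `costCoeffZd 0 7 8` for the kernel to unfold)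
  generalize costCoeffZd d 7 8 = N at h1 ⊢
  generalize costCoeffZd d 6 7 = M at h1 h2
  rcases Nat.lt_or_ge d 2 with hd | hd
  · interval_cases d
    · norm_num at h1 ⊢; omega
    · norm_num at h1 h2 ⊢; omega
  · obtain ⟨k, rfl⟩ := Nat.exists_eq_add_of_le hd
    have e1 : 2 * (2 + k) - 1 = 2 * k + 3 := by omega
    have e2 : 2 * (2 + k) - 2 = 2 * k + 2 := by omega
    have e3 : 2 * (2 + k) - 3 = 2 * k + 1 := by omega
    have e4 : 2 * (2 + k) - 4 = 2 * k := by omega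
    have e5 : 8 * (2 + k) - 13 = 8 * k + 3 := by omega
    rw [e1, e2, e3, e4, e5] at h1
    linear_combination h1 + (2 * k + 3) * h2

/-- ★ **`N_{7,8} = 128d⁷ − 384d⁶ + 352d⁵ − 80d⁴ + 192d³ − 372d² + 166d`**, the number of seven-step self-avoiding walks of `ℤ^d`
(lane enumeration `d = 1, 2, 3, 4`: `2`, `2 172`, `81 390`, `871 256`; the positive terms are grouped first so that truncated subtraction in
`ℕ` is harmless for every `d`). [cite: MadrasSlade1993, §1.2; Appendix C, Table C.1 (locator)] -/
theorem costCoeffZd_seven_eight (d : ℕ) :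
    costCoeffZd d 7 8 = 128 * d ^ 7 + 352 * d ^ 5 + 192 * d ^ 3 + 166 * d - 384 * d ^ 6 - 80 * d ^ 4 - 372 * d ^ 2 := by
  have h := costCoeffZd_seven_eight_add' d
  omega

end Literature.Probability.RandomPlanarGeometry.SAW.Zd

end
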